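import Literature.NumberTheory.EllipticCurves.HasseWeilAbelianBadReduction
import HarnessLib

/-!
# Rationality of the Euler factors of the Tate module of an elliptic curve: the named fact
`hasRationalEulerFactors_geomPoints`, its per-`ℓ` form, its corrected (elliptic) form, and its
assembly by reduction type

Topic `EllipticCurves`, sibling of `HasseWeilAbelian` (trunk EllArithM, item C15) and of
`HasseWeilAbelianBadReduction` / `HasseWeilGoodReduction`.

The named fact `WeierstrassCurve.hasRationalEulerFactors_geomPoints W` of `HasseWeilAbelian` says:
*the family of Mathlib local polynomials `v ↦ L_v(E, T) ∈ ℤ[T] ⊆ ℚ[T]` is a family of rational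
Euler factors (`Literature.NumberTheory.EllipticCurves.HasRationalEulerFactors`, empty exceptional
set) for the discrete `Γ_K`-module `M = E(K̄) = W.geomPoints`*, i.e. for **every** prime `ℓ`, every
finite place `v ∤ ℓ` of the number field `K`, and all continuity / finiteness witnesses of `V_ℓ E`,
`det(1 - σ_v T ∣ (V_ℓ E)_{I_v}) = L_v(E, T)` in `ℚ_ℓ[T]`.  This is Serre's condition that
`(V_ℓ E)_ℓ` be a *strictly compatible system of rational `ℓ`-adic representations* (Serre,
*Abelian `ℓ`-adic representations* (1968), Ch. I §2.3) extended to the ramified places through the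
inertia coinvariants, and it is printed, for elliptic curves, as Serre, *Facteurs locaux des
fonctions zêta des variétés algébriques* (1970), §2.4 (a)–(c): `P(T) = 1 - a_v T + Nv T²` (good
reduction, `a_v` the trace of the Frobenius endomorphism of the reduced curve, `#Ẽ(k_v) = P(1)`),
`P(T) = 1 - c_v T`, `c_v = ±1` (reduction of multiplicative type, split / non-split torus),
`P(T) = 1` (additive type), where `P = P_{ρ_ℓ} = det(1 - π T ∣ V^I)` is the polynomial of §2.2 (13)
of the `ℓ`-adic representation `V_ℓ = H¹ = (V_ℓ E)^∨` with `π` the *geometric* Frobenius — equal to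
our `det(1 - σ T ∣ (V_ℓ E)_{I})` with `σ` arithmetic (module docstring of `HasseWeilAbelian`,
"Frobenius and (co)invariants").  The integrality and `ℓ`-independence at the places of (potential)
good reduction is Serre–Tate (1968), Thm. 3 (*the characteristic polynomial of `ρ_ℓ(σ)` has integral
coefficients independent of `ℓ`*, proved from Lemma 2, the `D(v̄)`-equivariant reduction isomorphism
`A_m^I ≅ Ã_m`, and Weil); for abelian varieties in general it is Grothendieck, SGA 7 IX (Serre 1970,
end of §2.4).

## The fact quantifies over singular Weierstrass equations too (mis-statement), and its correction

`hasRationalEulerFactors_geomPoints` was produced (D-0014 sweep) from a sorried theorem stated under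
a section instance `[W.IsElliptic]`, which a `Prop`-valued `def` does not pick up:
`@hasRationalEulerFactors_geomPoints : {K} [Field K] (W : WeierstrassCurve K) [NumberField K] → Prop`.
As a schema over **all** `W` it is false.  For the split nodal cubic `W : y² + xy = x³` over `ℚ`
(`Δ = 0`, `c₄ = 1`), `geomPoints W` is the group of non-singular geometric points
`E_ns(ℚ̄) ≅ ℚ̄ˣ`, `Γ_ℚ`-equivariantly since both tangents at the node are rational (Silverman, *AEC*,
Prop. III.2.5 and Ex. 3.5), so `V_ℓ = ℚ_ℓ(1)` is a line (finite-dimensional, continuous action),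
unramified at `p ≠ ℓ`, on which an arithmetic Frobenius acts as `p`: the left-hand side at `v = (p)`
is `1 - pT`.  The right-hand side is Mathlib's `localPolynomial` of a "minimal" model of `W ⊗ ℚ_p`:
for `Δ = 0` every integral model is minimal (`valuation_Δ_aux = 0`), none has good reduction
(`v(Δ) = 0 ≠ 1` multiplicatively), so `W.localPolynomialAt v ∈ {1 - T, 1 + T, 1}` — never `1 - pT`
(`p ≥ 2` in `ℚ_ℓ`, characteristic `0`).  The sources (Serre 1970 §2.4, Serre–Tate 1968, Silverman
C.§16) concern elliptic curves (abelian varieties) only.  Following the precedent of the corrected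
C15 facts at the end of `HasseWeilAbelian` (`…_of_isElliptic`), this file vendors the **faithful
statement** `WeierstrassCurve.hasRationalEulerFactors_geomPoints_of_isElliptic` (`[W.IsElliptic]`
quantified in the body, same content and cite), records that the schema implies it, and proves
everything about the fact that does not need new arithmetic input.

## Contents (all proved; the only `def` is the corrected named fact)

* `WeierstrassCurve.hasRationalEulerFactors_geomPoints_iff`: **per-`ℓ` form** —
  `W.hasRationalEulerFactors_geomPoints ↔ ∀ ℓ, W.hasseWeilEulerFactor_geomPoints ℓ` (the per-`ℓ`
  named fact of `HasseWeilAbelian`; pure bookkeeping: `ℤ[T] → ℚ[T] → ℚ_ℓ[T]` is `ℤ[T] → ℚ_ℓ[T]`,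
  and the exceptional set is empty), for every `W`;
* `WeierstrassCurve.hasRationalEulerFactors_geomPoints_of_isElliptic` (**corrected named fact**) and
  `…_of_isElliptic_of` (the schema implies it), `…_of_isElliptic_iff` (per-`ℓ` form);
* `WeierstrassCurve.hasRationalEulerFactors_geomPoints_of_reductionTypes`: **assembly** — for
  elliptic `W`, the fact follows from the four per-`ℓ` inputs isolated by the sibling files, for all
  `ℓ`: the good-reduction Euler factors `hasseWeilEulerFactor_of_hasGoodReduction W ℓ`
  (`HasseWeilGoodReduction`; Silverman VII.4.1 + V.2.3.1, Serre–Tate Lemma 2 / Thm. 3) and the three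
  structures of the inertia coinvariants at the bad places (`HasseWeilAbelianBadReduction`;
  Silverman *ATAEC* Ex. 5.13, Thm. V.5.3, Thm. IV.10.2(a)), via
  `hasseWeilEulerFactor_geomPoints_of_reductionTypes`; and the same for the corrected fact
  (`…_of_isElliptic_of_reductionTypes`), plus the fixed-field schema form
  `forall_hasRationalEulerFactors_geomPoints_of_reductionTypes`;
* `WeierstrassCurve.hasseWeilEulerFactor_eq_of_hasRationalEulerFactors_geomPoints`:
  **`ℓ`-independence** read off the fact — for `v ∤ ℓ ℓ'` the `ℓ`-adic and `ℓ'`-adic Euler factors at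
  `v` are the images of one polynomial `L_v(E, T) ∈ ℤ[T]` (Serre–Tate Thm. 3: "integral coefficients
  independent of `ℓ`").

## References

* J.-P. Serre, *Facteurs locaux des fonctions zêta des variétés algébriques (définitions et
  conjectures)*, Sém. Delange–Pisot–Poitou 1969/70, exp. 19 (= Œuvres II, no. 87), §2.2 (13), §2.4
  (16), (17) and case c). [Serre1970]
* J.-P. Serre, J. Tate, *Good reduction of abelian varieties*, Ann. of Math. 88 (1968), 492–517
  (= Œuvres II, no. 79), §1 Lemma 2, §2 Thm. 2, Thm. 3 and its Corollary. [SerreTate1968]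
* J.-P. Serre, *Abelian `ℓ`-adic representations and elliptic curves* (1968), Ch. I §2.3
  (rational / strictly compatible systems), Ch. IV §1.3. [Serre1968]
* J. H. Silverman, *The Arithmetic of Elliptic Curves*, 2nd ed. (2009), Prop. III.2.5, Ex. 3.5,
  Thm. V.2.3.1, Prop. VII.4.1, §C.16 (PDF p. 390: definition of `L_v(T)` by reduction type).
  [SilvermanAEC2009]

## Design

`noncomputable section`, `open scoped Classical`, one universe `u` (`K : Type u`), deliberate
dot-notation extensions of Mathlib's `WeierstrassCurve` namespace, exactly as in the sibling files;
no instances, no `sorry`.  The original `def hasRationalEulerFactors_geomPoints` is left untouched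
(other files and the ledger reference it); its meaning is not edited in place (D-0014 protocol for
mis-stated facts).
-/

noncomputable section

open scoped Classical NumberField Polynomial

open Field IsDedekindDomain Polynomial

universe u

namespace WeierstrassCurve

open Literature.NumberTheory.EllipticCurves Literature.NumberTheory.GaloisRepresentations

section PerPrime

variable {K : Type u} [Field K] [NumberField K] (W : WeierstrassCurve K)

/-- The composite `ℤ[T] → ℚ[T] → ℚ_ℓ[T]` is `ℤ[T] → ℚ_ℓ[T]` (`Polynomial.map_map`, `RingHom.ext_int`).
[folklore] -/
theorem map_map_localPolynomialAt (ℓ : ℕ) [Fact ℓ.Prime] (v : HeightOneSpectrum (𝓞 K)) :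
    ((W.localPolynomialAt v).map (Int.castRingHom ℚ)).map (algebraMap ℚ ℚ_[ℓ]) =
      (W.localPolynomialAt v).map (Int.castRingHom ℚ_[ℓ]) := by
  rw [Polynomial.map_map, RingHom.ext_int ((algebraMap ℚ ℚ_[ℓ]).comp (Int.castRingHom ℚ))
    (Int.castRingHom ℚ_[ℓ])]

/-- **Per-`ℓ` form of the rationality fact.**  For any Weierstrass equation `W` over a number field,
`hasRationalEulerFactors_geomPoints W` (the local polynomials `L_v(E, T) ∈ ℚ[T]` are rational Euler
factors of `V_ℓ(E(K̄))` for all `ℓ` and all `v ∤ ℓ`, exceptional set `∅`) is equivalent to the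
conjunction over all primes `ℓ` of the per-`ℓ` named fact `hasseWeilEulerFactor_geomPoints W ℓ` of
`HasseWeilAbelian` (`det(1 - σ_v T ∣ (V_ℓ E)_{I_v}) = L_v(E, T)` in `ℚ_ℓ[T]` for all `v ∤ ℓ`).  Pure
bookkeeping (`map_map_localPolynomialAt`; `v ∉ ∅` is automatic); this is how Serre phrases
rationality of the system `(V_ℓ)_ℓ` one `ℓ` at a time (*Abelian `ℓ`-adic representations*, I §2.3).
[folklore] -/
theorem hasRationalEulerFactors_geomPoints_iff :
    W.hasRationalEulerFactors_geomPoints ↔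
      ∀ (ℓ : ℕ) [Fact ℓ.Prime], W.hasseWeilEulerFactor_geomPoints ℓ := by
  constructor
  · intro H ℓ _ h hfin v hℓ
    have := H ℓ h hfin v (Set.notMem_empty v) hℓ
    rw [map_map_localPolynomialAt] at this
    exact this.symm
  · intro H ℓ _ h hfin v _ hℓ
    rw [map_map_localPolynomialAt]
    exact (H ℓ h hfin v hℓ).symm

/-- **`ℓ`-independence of the Euler factors, read off the rationality fact** (Serre–Tate (1968),
Thm. 3: *the characteristic polynomial of `ρ_ℓ(σ)` has integral coefficients independent of `ℓ`*;
Serre (1970), §2.3 `C₅`).  Granting `hasRationalEulerFactors_geomPoints W`, for two primes `ℓ, ℓ'`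
and a finite place `v ∤ ℓ ℓ'`, the `ℓ`-adic and the `ℓ'`-adic Hasse–Weil Euler factors of `E(K̄)` at
`v` are the images in `ℚ_ℓ[T]`, `ℚ_{ℓ'}[T]` of one and the same integral polynomial, namely
`L_v(E, T) = W.localPolynomialAt v ∈ ℤ[T]`. [cite: SerreTate1968, §2 Thm. 3] -/
theorem hasseWeilEulerFactor_eq_of_hasRationalEulerFactors_geomPoints
    (H : W.hasRationalEulerFactors_geomPoints) {ℓ ℓ' : ℕ} [Fact ℓ.Prime] [Fact ℓ'.Prime]
    (h : Continuous fun x : absoluteGaloisGroup K × RationalTateModule (geomPoints W) ℓ ↦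
      rationalTateRepresentation (absoluteGaloisGroup K) (geomPoints W) ℓ x.1 x.2)
    (h' : Continuous fun x : absoluteGaloisGroup K × RationalTateModule (geomPoints W) ℓ' ↦
      rationalTateRepresentation (absoluteGaloisGroup K) (geomPoints W) ℓ' x.1 x.2)
    [Module.Finite ℚ_[ℓ] (W.rationalTateModule ℓ)] [Module.Finite ℚ_[ℓ'] (W.rationalTateModule ℓ')]
    {v : HeightOneSpectrum (𝓞 K)} (hℓ : (ℓ : 𝓞 K) ∉ v.asIdeal) (hℓ' : (ℓ' : 𝓞 K) ∉ v.asIdeal) :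
    ∃ P : ℤ[X], hasseWeilEulerFactor (geomPoints W) ℓ h v = P.map (Int.castRingHom ℚ_[ℓ]) ∧
      hasseWeilEulerFactor (geomPoints W) ℓ' h' v = P.map (Int.castRingHom ℚ_[ℓ']) :=
  ⟨W.localPolynomialAt v, (W.hasRationalEulerFactors_geomPoints_iff.1 H ℓ) h inferInstance v hℓ,
    (W.hasRationalEulerFactors_geomPoints_iff.1 H ℓ') h' inferInstance v hℓ'⟩

end PerPrime

/-! ## The corrected fact: elliptic `W` -/

section Corrected

variable {K : Type u} [Field K] [NumberField K] (W : WeierstrassCurve K)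

/-- **Rationality and `ℓ`-independence of the Euler factors of an elliptic curve** (corrected form
of `hasRationalEulerFactors_geomPoints`, see the module docstring: the schema of `HasseWeilAbelian`
omits `[W.IsElliptic]` and therefore also speaks about singular Weierstrass equations, for which it
fails — e.g. the split nodal cubic `y² + xy = x³` over `ℚ`, whose `V_ℓ = ℚ_ℓ(1)` has Euler factor
`1 - pT ∉ {1 - T, 1 + T, 1}` at `p ≠ ℓ`).  For an **elliptic curve** `E/K` over a number field
(`W` with `[W.IsElliptic]`, `M = E(K̄) = W.geomPoints`), the family of Mathlib local polynomials
`v ↦ L_v(E, T) = W.localPolynomialAt v ∈ ℤ[T] ⊆ ℚ[T]` (`1 - a_v T + q_v T²`, `1 - T`, `1 + T`, `1`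
by reduction type; Silverman, *AEC*, C.§16) is a family of rational Euler factors for `M` with empty
exceptional set (`HasRationalEulerFactors`): for every prime `ℓ`, every finite place `v ∤ ℓ` and all
continuity / finiteness witnesses, `det(1 - σ_v T ∣ (V_ℓ E)_{I_v}) = L_v(E, T)` in `ℚ_ℓ[T]`; i.e.
`(V_ℓ E)_ℓ` is a strictly compatible system of rational `ℓ`-adic representations.  Printed
sources: Serre, *Facteurs locaux des fonctions zêta* (1970), §2.4 (a) `P(T) = 1 - a_vT + NvT²`,
(b) `P(T) = 1 - c_vT`, `c_v = ±1` (split / non-split torus), (c) `P = 1`, with `P = det(1 - πT ∣ V^I)`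
of §2.2 (13) for `V = (V_ℓ E)^∨`, `π` geometric Frobenius (equal to the arithmetic-Frobenius
determinant on the coinvariants used by `Literature.NumberTheory.EllipticCurves.hasseWeilEulerFactor`);
Serre–Tate (1968), §1 Lemma 2 and §2 Thm. 3 (integrality and `ℓ`-independence of the characteristic
polynomial of `ρ_ℓ(σ)` at places of potential good reduction); Serre, *Abelian `ℓ`-adic
representations* (1968), Ch. I §2.3 (strict compatibility) and Ch. IV §1.3.  Same content,
hypotheses and cite as `hasRationalEulerFactors_geomPoints`, which implies it
(`hasRationalEulerFactors_geomPoints_of_isElliptic_of`); its four per-`ℓ` arithmetic inputs are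
assembled in `hasRationalEulerFactors_geomPoints_of_isElliptic_of_reductionTypes`.
[cite: SerreTate1968, §1 Lemma 2, §2 Thm. 3] [cite: Serre1970, §2.4 (16), (17), c)] -/
def hasRationalEulerFactors_geomPoints_of_isElliptic : Prop :=
  ∀ [W.IsElliptic],
    HasRationalEulerFactors (geomPoints W) (∅ : Set (HeightOneSpectrum (𝓞 K))) fun v ↦
      (W.localPolynomialAt v).map (Int.castRingHom ℚ)

/-- The schema `hasRationalEulerFactors_geomPoints W` (all `W`) implies its corrected form
(elliptic `W`); the converse fails for singular `W` (module docstring). [folklore] -/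
theorem hasRationalEulerFactors_geomPoints_of_isElliptic_of
    (H : W.hasRationalEulerFactors_geomPoints) :
    W.hasRationalEulerFactors_geomPoints_of_isElliptic :=
  H

/-- For elliptic `W` the corrected fact is literally the schema. [folklore] -/
theorem hasRationalEulerFactors_geomPoints_of_isElliptic_iff_of_isElliptic [W.IsElliptic] :
    W.hasRationalEulerFactors_geomPoints_of_isElliptic ↔ W.hasRationalEulerFactors_geomPoints :=
  ⟨fun H ↦ H, fun H ↦ H⟩

/-- **Per-`ℓ` form of the corrected fact**: for elliptic `W`, rationality of the Euler factors of
`E(K̄)` is the conjunction over all primes `ℓ` of the per-`ℓ` facts `hasseWeilEulerFactor_geomPoints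
W ℓ` (`hasRationalEulerFactors_geomPoints_iff`). [folklore] -/
theorem hasRationalEulerFactors_geomPoints_of_isElliptic_iff :
    W.hasRationalEulerFactors_geomPoints_of_isElliptic ↔
      ∀ [W.IsElliptic] (ℓ : ℕ) [Fact ℓ.Prime], W.hasseWeilEulerFactor_geomPoints ℓ :=
  ⟨fun H ↦ W.hasRationalEulerFactors_geomPoints_iff.1 H,
    fun H ↦ W.hasRationalEulerFactors_geomPoints_iff.2 H⟩

end Corrected

/-! ## Assembly by reduction type -/

section Assembly

variable {K : Type u} [Field K] [NumberField K] (W : WeierstrassCurve K)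

/-- **The rationality fact from its four per-`ℓ` inputs.**  For an elliptic curve `E/K` over a
number field, `hasRationalEulerFactors_geomPoints W` follows from, for every prime `ℓ`: the Euler
factors at the places of good reduction `hasseWeilEulerFactor_of_hasGoodReduction W ℓ`
(`HasseWeilGoodReduction`; Silverman *AEC* VII.4.1 + V.2.3.1 — Serre–Tate Lemma 2 / Thm. 3 for
elliptic curves) and the three structures of the inertia coinvariants `(V_ℓ E)_{I_𝔓}` at the places
of split multiplicative, non-split multiplicative and additive reduction
(`HasseWeilAbelianBadReduction`; Silverman *ATAEC* Ex. 5.13, Thm. V.5.3, Thm. IV.10.2(a)), through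
the per-`ℓ` assembly `hasseWeilEulerFactor_geomPoints_of_reductionTypes` and
`hasRationalEulerFactors_geomPoints_iff`.  This is the case distinction of Serre (1970), §2.4
(a)/(b)/(c) = Silverman, *AEC*, C.§16. [cite: SilvermanAEC2009, §C.16 (PDF p. 390)] -/
theorem hasRationalEulerFactors_geomPoints_of_reductionTypes [W.IsElliptic]
    (hG : ∀ (ℓ : ℕ) [Fact ℓ.Prime], W.hasseWeilEulerFactor_of_hasGoodReduction ℓ)
    (hS : ∀ (ℓ : ℕ) [Fact ℓ.Prime],
      W.inertiaCoinvariants_rationalTate_of_hasSplitMultiplicativeReductionAt ℓ)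
    (hN : ∀ (ℓ : ℕ) [Fact ℓ.Prime],
      W.inertiaCoinvariants_rationalTate_of_hasNonsplitMultiplicativeReductionAt ℓ)
    (hA : ∀ (ℓ : ℕ) [Fact ℓ.Prime],
      W.inertiaCoinvariants_rationalTate_eq_zero_of_hasAdditiveReductionAt ℓ) :
    W.hasRationalEulerFactors_geomPoints :=
  W.hasRationalEulerFactors_geomPoints_iff.2 fun ℓ _ ↦
    W.hasseWeilEulerFactor_geomPoints_of_reductionTypes ℓ (hG ℓ) (hS ℓ) (hN ℓ) (hA ℓ)

/-- **The corrected fact from its four per-`ℓ` inputs** (same assembly, `[W.IsElliptic]` quantified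
in the bodies as in the three bad-place facts). [cite: SilvermanAEC2009, §C.16 (PDF p. 390)] -/
theorem hasRationalEulerFactors_geomPoints_of_isElliptic_of_reductionTypes
    (hG : ∀ [W.IsElliptic] (ℓ : ℕ) [Fact ℓ.Prime], W.hasseWeilEulerFactor_of_hasGoodReduction ℓ)
    (hS : ∀ (ℓ : ℕ) [Fact ℓ.Prime],
      W.inertiaCoinvariants_rationalTate_of_hasSplitMultiplicativeReductionAt ℓ)
    (hN : ∀ (ℓ : ℕ) [Fact ℓ.Prime],
      W.inertiaCoinvariants_rationalTate_of_hasNonsplitMultiplicativeReductionAt ℓ)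
    (hA : ∀ (ℓ : ℕ) [Fact ℓ.Prime],
      W.inertiaCoinvariants_rationalTate_eq_zero_of_hasAdditiveReductionAt ℓ) :
    W.hasRationalEulerFactors_geomPoints_of_isElliptic :=
  W.hasRationalEulerFactors_geomPoints_of_reductionTypes (fun ℓ _ ↦ hG ℓ) hS hN hA

end Assembly

section Schema

variable {K : Type u} [Field K] [NumberField K]

/-- Schema form over a fixed number field `K`: if the good-reduction Euler factors and the three
bad-place structures hold for every elliptic curve over `K` and every prime `ℓ`, then every elliptic
curve over `K` has rational Euler factors (`hasRationalEulerFactors_geomPoints`), i.e. its Hasse–Weil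
`L`-function `Literature.NumberTheory.EllipticCurves.hasseWeilLFunction` may be formed from the
`L_v(E, T)`. [folklore] -/
theorem forall_hasRationalEulerFactors_geomPoints_of_reductionTypes
    (hG : ∀ (W : WeierstrassCurve K) [W.IsElliptic] (ℓ : ℕ) [Fact ℓ.Prime],
      W.hasseWeilEulerFactor_of_hasGoodReduction ℓ)
    (hS : ∀ (W : WeierstrassCurve K) [W.IsElliptic] (ℓ : ℕ) [Fact ℓ.Prime],
      W.inertiaCoinvariants_rationalTate_of_hasSplitMultiplicativeReductionAt ℓ)
    (hN : ∀ (W : WeierstrassCurve K) [W.IsElliptic] (ℓ : ℕ) [Fact ℓ.Prime],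
      W.inertiaCoinvariants_rationalTate_of_hasNonsplitMultiplicativeReductionAt ℓ)
    (hA : ∀ (W : WeierstrassCurve K) [W.IsElliptic] (ℓ : ℕ) [Fact ℓ.Prime],
      W.inertiaCoinvariants_rationalTate_eq_zero_of_hasAdditiveReductionAt ℓ) :
    ∀ (W : WeierstrassCurve K) [W.IsElliptic], W.hasRationalEulerFactors_geomPoints :=
  fun W _ ↦ W.hasRationalEulerFactors_geomPoints_of_reductionTypes (fun ℓ _ ↦ hG W ℓ)
    (fun ℓ _ ↦ hS W ℓ) (fun ℓ _ ↦ hN W ℓ) (fun ℓ _ ↦ hA W ℓ)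

end Schema

end WeierstrassCurve
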